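import Literature.MathematicalPhysics.QuantumFieldTheory.Balaban1983to89.Beta.KKTFluctuationEnergy

/-!
# `BalabanUV.Beta.GAN24.CellRefinement` — binder row G-an2-4 / (CONV-C), S-slot, road «S3»: THE GENERIC CELL-REFINEMENT (RIEMANN-SUM
# COMPARISON) LEMMA «RIEMANN*» of `SKELETON-S3.md` v1.1 §15.2 — comparing a fine-lattice pairing `∑'_x f′ x·g′ x` with the coarse pairing
# `L^D·∑'_y f y·ḡ′ y` of a coarse function against the CELL MEANS of `g′` (engine of the idle leaf seat b2b-balaban-gan24-formalise-leaf-01-g10;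
# consumer: the RATE table's depth-paired difference rows dV∕dVt∕dL∕dLt of `GAN24/StencilSlotE3RateOfPieces`, together with (N1-Cauchy) = the
# cell-mean defect input and DILATE* = the cell structure of the dilated increments)

NOT IN PRINT; OUR PROOF ATTEMPT.  HONEST FRAMING (cell contract, verbatim): «discharging `BetaPertH` makes Bałaban's UV stability
UNCONDITIONAL — a real constructive-QFT result; it is NOT the continuum limit and NOT the Clay problem.»  HONEST DEPENDENCY (verbatim):
«continuum YM on T⁴ ⇐ BetaPertH ∧ nine spine estimates (0/9 proved); BetaPertH ⇐ (D1) ∧ (D4) ∧ CAP+tail; G-an2-4 gates asym, D1 and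
NE2/3/4.»  [folklore] real analysis on `ℤ^D` over pv∕an1's `KKTFluctuationEnergy.tsum_blocks`∕`summable_blocks` and `AffineAveraging.blockSum`
BY NAME; ONE plumbing def (`cellMean`); no cited fact, no `Prop` mirror; every summability is an explicit hypothesis.  Discharges NOTHING of the
RATE rows, «E3SupRate», (hS, hSall), BetaPertH; NOT continuum, NOT Clay.

## What is proved (generic `D`, blocking factor `L ≥ 1`; `cellMean L h y := (L^D)⁻¹·blockSum L h y`)
§1 `blockSum_eq_mul_cellMean`, `sum_sub_cellMean` (deviations from the cell mean sum to zero), **`cell_identity`**: for ANY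
   comparison value `a`, `Σ_{b∈box} f′(L•y+b)·g′(L•y+b) − L^D·a·ḡ′(y) = L^D·(f̄′(y) − a)·ḡ′(y) + Σ_b (f′ − f̄′)(g′ − ḡ′)` — defect × mean + CELL
   COVARIANCE, the covariance being SECOND ORDER in the two cell oscillations.
§2 **`refine_identity`** («RIEMANN*», exact): for summable `f′·g′` and summable `y ↦ f y·ḡ′ y`,
   `∑'_x f′ x·g′ x − L^D·∑'_y f y·cellMean L g′ y = ∑'_y [L^D·(cellMean L f′ y − f y)·cellMean L g′ y + cellCov_y(f′,g′)]`
   (`summable_refine_rhs`); **`abs_refine_le`** (≤ `∑' e` for any summable majorant `e` of the per-cell error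
   `L^D·|f̄′ − f|·|ḡ′| + Σ_b |f′ − f̄′|·|g′ − ḡ′|`); `refine_identity_normalised` (the `N′ = N·L` form: `N′^{−D}∑' f′g′ − N^{−D}∑'_y f·ḡ′ = N′^{−D}·∑'_y […]`);
   **`abs_refine_le_weighted`**: defect `|f̄′ y − f y| ≤ ε·w y`, `|ḡ′ y| ≤ G`, oscillations `|f′(L•y+b) − f̄′ y| ≤ η·w y`, `|g′(L•y+b) − ḡ′ y| ≤ γ`, `w`
   summable ⇒ `|∑' f′g′ − L^D·∑'_y f·ḡ′| ≤ L^D·(ε·G + η·γ)·∑' w` — §15.2's «(cell-mean defect) × sup|g| + (oscillation)» shape with the second term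
   improved to osc(f′)·osc(g′).  READING for the RATE rows (not claimed here): `f′ = H̃_{N·Lc}(· − (N·Lc)•u′)`, `f = H̃_N(· − N•u′)`, `g′` = the rest of
   the member-(n+3) unit sandwich at the vertex location; the defect is (N1-Cauchy) (cell-MEAN form), the oscillation of `f′` is (N1′), and if DILATE* makes
   `g′` cell-constant the covariance term vanishes identically.
-/

noncomputable section

open Finset
open scoped BigOperators
open Literature.MathematicalPhysics.QuantumFieldTheory
open Literature.MathematicalPhysics.QuantumFieldTheory.Balaban1983to89
open Literature.MathematicalPhysics.QuantumFieldTheory.Balaban1983to89.Beta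
open AffineAveraging (Site box toSite blockSum)
open KKTFluctuationEnergy (tsum_blocks summable_blocks)

namespace Summit.QuantumFields.BalabanUV.Beta.GAN24.CellRefinement

variable {D : ℕ} {L : ℕ} [NeZero L]

/-! ## §1 Cell means and the per-cell algebra -/

/-- [folklore] The CELL MEAN of a fine function over the `L`-cell of the coarse point `y`: `(L^D)⁻¹ · Σ_{b ∈ box} h (L•y + b)`. -/
def cellMean (L : ℕ) (h : Site D → ℝ) (y : Site D) : ℝ := ((L : ℝ) ^ D)⁻¹ * blockSum L h y

omit [NeZero L] in
/-- [folklore] `blockSum = L^D · cellMean`. -/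
theorem blockSum_eq_mul_cellMean (hL : L ≠ 0) (h : Site D → ℝ) (y : Site D) :
    blockSum L h y = (L : ℝ) ^ D * cellMean L h y := by
  have : ((L : ℝ) ^ D) ≠ 0 := pow_ne_zero _ (by exact_mod_cast hL)
  rw [cellMean, ← mul_assoc, mul_inv_cancel₀ this, one_mul]

omit [NeZero L] in
/-- [folklore] The deviations from the cell mean sum to zero over the cell. -/
theorem sum_sub_cellMean (hL : L ≠ 0) (h : Site D → ℝ) (y : Site D) :
    ∑ b ∈ box D L, (h ((L : ℤ) • y + toSite b) - cellMean L h y) = 0 := by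
  have card_box : (box D L).card = L ^ D := by
    unfold AffineAveraging.box
    rw [Fintype.card_piFinset, Finset.prod_const, Finset.card_range, Finset.card_univ, Fintype.card_fin]
  rw [Finset.sum_sub_distrib, Finset.sum_const, card_box, nsmul_eq_mul, Nat.cast_pow]
  change blockSum L h y - (L : ℝ) ^ D * cellMean L h y = 0
  rw [blockSum_eq_mul_cellMean hL, sub_self]

omit [NeZero L] in
/-- [folklore] **THE PER-CELL IDENTITY**: for ANY coarse comparison value `a`,
`Σ_b f′(L•y+b)·g′(L•y+b) = L^D·(f̄′ − a)·ḡ′ + L^D·a·ḡ′ + Σ_b (f′ − f̄′)(g′ − ḡ′)` — i.e.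
`Σ_b f′g′ − L^D·a·ḡ′ = L^D·(f̄′(y) − a)·ḡ′(y) + cellCov(f′,g′)(y)`, the covariance being SECOND ORDER in the two cell oscillations. -/
theorem cell_identity (hL : L ≠ 0) (f' g' : Site D → ℝ) (a : ℝ) (y : Site D) :
    (∑ b ∈ box D L, f' ((L : ℤ) • y + toSite b) * g' ((L : ℤ) • y + toSite b)) - (L : ℝ) ^ D * a * cellMean L g' y =
      (L : ℝ) ^ D * (cellMean L f' y - a) * cellMean L g' y +
        ∑ b ∈ box D L, (f' ((L : ℤ) • y + toSite b) - cellMean L f' y) * (g' ((L : ℤ) • y + toSite b) - cellMean L g' y) := by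
  have card_box : (box D L).card = L ^ D := by
    unfold AffineAveraging.box
    rw [Fintype.card_piFinset, Finset.prod_const, Finset.card_range, Finset.card_univ, Fintype.card_fin]
  have hf : blockSum L f' y = (L : ℝ) ^ D * cellMean L f' y := blockSum_eq_mul_cellMean hL f' y
  have hg : blockSum L g' y = (L : ℝ) ^ D * cellMean L g' y := blockSum_eq_mul_cellMean hL g' y
  -- expand the covariance sum
  have hcov : (∑ b ∈ box D L, (f' ((L : ℤ) • y + toSite b) - cellMean L f' y) * (g' ((L : ℤ) • y + toSite b) - cellMean L g' y)) =
      (∑ b ∈ box D L, f' ((L : ℤ) • y + toSite b) * g' ((L : ℤ) • y + toSite b)) -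
        cellMean L g' y * blockSum L f' y - cellMean L f' y * blockSum L g' y +
        (L : ℝ) ^ D * (cellMean L f' y * cellMean L g' y) := by
    simp only [sub_mul, mul_sub, Finset.sum_sub_distrib, Finset.sum_const, card_box, nsmul_eq_mul, Nat.cast_pow, blockSum,
      ← Finset.sum_mul, ← Finset.mul_sum]
    ring
  rw [hcov, hf, hg]
  ring

/-! ## §2 The lattice identity and the bounds (summability explicit) -/

omit [NeZero L] in
/-- [folklore] Absolute value of the covariance sum ≤ the sum of the products of the two cell oscillations (pointwise deviations). -/
theorem abs_cov_le (f' g' : Site D → ℝ) (y : Site D) :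
    |∑ b ∈ box D L, (f' ((L : ℤ) • y + toSite b) - cellMean L f' y) * (g' ((L : ℤ) • y + toSite b) - cellMean L g' y)| ≤
      ∑ b ∈ box D L, |f' ((L : ℤ) • y + toSite b) - cellMean L f' y| * |g' ((L : ℤ) • y + toSite b) - cellMean L g' y| := by
  refine (Finset.abs_sum_le_sum_abs _ _).trans (le_of_eq ?_)
  exact Finset.sum_congr rfl fun b _ => abs_mul _ _

/-- [folklore] **«RIEMANN*» — THE CELL-REFINEMENT IDENTITY ON THE LATTICE.**  For a summable fine product `f′·g′` and ANY coarse comparison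
function `f` with `y ↦ f y · cellMean L g′ y` summable:
`∑'_x f′ x · g′ x − L^D · ∑'_y f y · cellMean L g′ y = ∑'_y [ L^D·(cellMean L f′ y − f y)·cellMean L g′ y + cellCov_y(f′, g′) ]`
(cell-mean DEFECT × cell mean + cell COVARIANCE); the right-hand series is summable. -/
theorem refine_identity (f' g' f : Site D → ℝ) (hfg : Summable fun x => f' x * g' x) (hc : Summable fun y => f y * cellMean L g' y) :
    (∑' x, f' x * g' x) - (L : ℝ) ^ D * ∑' y, f y * cellMean L g' y =
      ∑' y, ((L : ℝ) ^ D * (cellMean L f' y - f y) * cellMean L g' y +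
        ∑ b ∈ box D L, (f' ((L : ℤ) • y + toSite b) - cellMean L f' y) * (g' ((L : ℤ) • y + toSite b) - cellMean L g' y)) := by
  have hL : L ≠ 0 := NeZero.ne L
  rw [tsum_blocks (N := L) hfg, ← tsum_mul_left, ← Summable.tsum_sub (summable_blocks (N := L) hfg) (hc.mul_left _)]
  refine tsum_congr fun y => ?_
  rw [show (L : ℝ) ^ D * (f y * cellMean L g' y) = (L : ℝ) ^ D * f y * cellMean L g' y by ring]
  exact cell_identity hL f' g' (f y) y

/-- [folklore] Summability of the right-hand side of `refine_identity` (as the difference of two summable block families). -/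
theorem summable_refine_rhs (f' g' f : Site D → ℝ) (hfg : Summable fun x => f' x * g' x) (hc : Summable fun y => f y * cellMean L g' y) :
    Summable fun y => ((L : ℝ) ^ D * (cellMean L f' y - f y) * cellMean L g' y +
      ∑ b ∈ box D L, (f' ((L : ℤ) • y + toSite b) - cellMean L f' y) * (g' ((L : ℤ) • y + toSite b) - cellMean L g' y)) := by
  have hL : L ≠ 0 := NeZero.ne L
  have h := (summable_blocks (N := L) hfg).sub (hc.mul_left ((L : ℝ) ^ D))
  refine h.congr fun y => ?_
  show (∑ b ∈ box D L, f' ((L : ℤ) • y + toSite b) * g' ((L : ℤ) • y + toSite b)) - (L : ℝ) ^ D * (f y * cellMean L g' y) = _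
  rw [show (L : ℝ) ^ D * (f y * cellMean L g' y) = (L : ℝ) ^ D * f y * cellMean L g' y by ring]
  exact cell_identity hL f' g' (f y) y

/-- [folklore] **«RIEMANN*» — THE BOUND.**  If the per-cell error terms are dominated by a summable majorant `e`
(`L^D·|f̄′ y − f y|·|ḡ′ y| + Σ_b |f′ − f̄′|·|g′ − ḡ′| ≤ e y`), then `|∑' f′g′ − L^D·∑'_y f·ḡ′| ≤ ∑' e`. -/
theorem abs_refine_le (f' g' f e : Site D → ℝ) (hfg : Summable fun x => f' x * g' x) (hc : Summable fun y => f y * cellMean L g' y)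
    (he : Summable e)
    (hdom : ∀ y, (L : ℝ) ^ D * |cellMean L f' y - f y| * |cellMean L g' y| +
      ∑ b ∈ box D L, |f' ((L : ℤ) • y + toSite b) - cellMean L f' y| * |g' ((L : ℤ) • y + toSite b) - cellMean L g' y| ≤ e y) :
    |(∑' x, f' x * g' x) - (L : ℝ) ^ D * ∑' y, f y * cellMean L g' y| ≤ ∑' y, e y := by
  rw [refine_identity f' g' f hfg hc]
  have hs := summable_refine_rhs (L := L) f' g' f hfg hc
  have hterm : ∀ y, |(L : ℝ) ^ D * (cellMean L f' y - f y) * cellMean L g' y +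
      ∑ b ∈ box D L, (f' ((L : ℤ) • y + toSite b) - cellMean L f' y) * (g' ((L : ℤ) • y + toSite b) - cellMean L g' y)| ≤ e y := by
    intro y
    refine (abs_add_le _ _).trans ((add_le_add ?_ (abs_cov_le f' g' y)).trans (hdom y))
    rw [abs_mul, abs_mul, abs_of_nonneg (by positivity : (0 : ℝ) ≤ (L : ℝ) ^ D)]
  calc |∑' y, ((L : ℝ) ^ D * (cellMean L f' y - f y) * cellMean L g' y +
        ∑ b ∈ box D L, (f' ((L : ℤ) • y + toSite b) - cellMean L f' y) * (g' ((L : ℤ) • y + toSite b) - cellMean L g' y))|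
      ≤ ∑' y, |(L : ℝ) ^ D * (cellMean L f' y - f y) * cellMean L g' y +
        ∑ b ∈ box D L, (f' ((L : ℤ) • y + toSite b) - cellMean L f' y) * (g' ((L : ℤ) • y + toSite b) - cellMean L g' y)| := by
          rw [← Real.norm_eq_abs]
          exact (norm_tsum_le_tsum_norm hs.norm).trans (le_of_eq (tsum_congr fun y => Real.norm_eq_abs _))
    _ ≤ ∑' y, e y := (hs.abs).tsum_le_tsum hterm he

/-- [folklore] **THE NORMALISED FORM** (`N′ = N·L` blocks vs `N` blocks): dividing `refine_identity` by `N′^D`,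
`N′^{−D}·∑' f′g′ − N^{−D}·∑'_y f·ḡ′ = N′^{−D} · ∑'_y [L^D·(f̄′ − f)·ḡ′ + cellCov]`. -/
theorem refine_identity_normalised (N : ℕ) (hN : N ≠ 0) (f' g' f : Site D → ℝ) (hfg : Summable fun x => f' x * g' x)
    (hc : Summable fun y => f y * cellMean L g' y) :
    (((N * L : ℕ) : ℝ) ^ D)⁻¹ * (∑' x, f' x * g' x) - (((N : ℕ) : ℝ) ^ D)⁻¹ * ∑' y, f y * cellMean L g' y =
      (((N * L : ℕ) : ℝ) ^ D)⁻¹ * ∑' y, ((L : ℝ) ^ D * (cellMean L f' y - f y) * cellMean L g' y +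
        ∑ b ∈ box D L, (f' ((L : ℤ) • y + toSite b) - cellMean L f' y) * (g' ((L : ℤ) • y + toSite b) - cellMean L g' y)) := by
  rw [← refine_identity f' g' f hfg hc, mul_sub]
  congr 1
  have hL : (L : ℝ) ≠ 0 := by exact_mod_cast NeZero.ne L
  have hN' : (N : ℝ) ≠ 0 := by exact_mod_cast hN
  rw [Nat.cast_mul, mul_pow, mul_inv, mul_assoc, ← mul_assoc ((L : ℝ) ^ D)⁻¹, inv_mul_cancel₀ (pow_ne_zero _ hL), one_mul]

/-- [folklore] **THE WEIGHTED COROLLARY** (the shape the RATE rows use): a cell-mean DEFECT bound `|f̄′ y − f y| ≤ ε·w y`, a bound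
`|ḡ′ y| ≤ G`, cell OSCILLATION bounds `|f′(L•y+b) − f̄′ y| ≤ η·w y`, `|g′(L•y+b) − ḡ′ y| ≤ γ` (on the cell of `y`), with a summable
nonnegative weight `w`, give `|∑' f′g′ − L^D·∑'_y f·ḡ′| ≤ L^D·(ε·G + η·γ)·∑' w`. -/
theorem abs_refine_le_weighted (f' g' f w : Site D → ℝ) {ε G η γ : ℝ} (hfg : Summable fun x => f' x * g' x)
    (hc : Summable fun y => f y * cellMean L g' y) (hw : Summable w)
    (hdef : ∀ y, |cellMean L f' y - f y| ≤ ε * w y) (hmean : ∀ y, |cellMean L g' y| ≤ G)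
    (hoscf : ∀ y, ∀ b ∈ box D L, |f' ((L : ℤ) • y + toSite b) - cellMean L f' y| ≤ η * w y)
    (hoscg : ∀ y, ∀ b ∈ box D L, |g' ((L : ℤ) • y + toSite b) - cellMean L g' y| ≤ γ) :
    |(∑' x, f' x * g' x) - (L : ℝ) ^ D * ∑' y, f y * cellMean L g' y| ≤ (L : ℝ) ^ D * (ε * G + η * γ) * ∑' y, w y := by
  have card_box : (box D L).card = L ^ D := by
    unfold AffineAveraging.box
    rw [Fintype.card_piFinset, Finset.prod_const, Finset.card_range, Finset.card_univ, Fintype.card_fin]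
  have hε : ∀ y, 0 ≤ ε * w y := fun y => (abs_nonneg _).trans (hdef y)
  have hη : ∀ y, 0 ≤ η * w y := fun y => by
    obtain ⟨b, hb⟩ : (box D L).Nonempty := by
      rw [← Finset.card_pos, card_box]; exact pow_pos (Nat.pos_of_ne_zero (NeZero.ne L)) D
    exact (abs_nonneg _).trans (hoscf y b hb)
  have key := abs_refine_le (L := L) f' g' f (fun y => (L : ℝ) ^ D * (ε * G + η * γ) * w y) hfg hc (hw.mul_left _) (fun y => ?_)
  · rw [tsum_mul_left] at key; exact key
  have hLD : (0 : ℝ) ≤ (L : ℝ) ^ D := by positivity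
  have h1 : (L : ℝ) ^ D * |cellMean L f' y - f y| * |cellMean L g' y| ≤ (L : ℝ) ^ D * (ε * w y) * G := by
    rw [mul_assoc, mul_assoc]
    exact mul_le_mul_of_nonneg_left (mul_le_mul (hdef y) (hmean y) (abs_nonneg _) (hε y)) hLD
  have h2 : (∑ b ∈ box D L, |f' ((L : ℤ) • y + toSite b) - cellMean L f' y| * |g' ((L : ℤ) • y + toSite b) - cellMean L g' y|) ≤
      (L : ℝ) ^ D * (η * w y * γ) := by
    calc (∑ b ∈ box D L, |f' ((L : ℤ) • y + toSite b) - cellMean L f' y| * |g' ((L : ℤ) • y + toSite b) - cellMean L g' y|)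
        ≤ ∑ _b ∈ box D L, η * w y * γ :=
          Finset.sum_le_sum fun b hb => mul_le_mul (hoscf y b hb) (hoscg y b hb) (abs_nonneg _) (hη y)
      _ = (L : ℝ) ^ D * (η * w y * γ) := by rw [Finset.sum_const, card_box, nsmul_eq_mul, Nat.cast_pow]
  calc _ ≤ (L : ℝ) ^ D * (ε * w y) * G + (L : ℝ) ^ D * (η * w y * γ) := add_le_add h1 h2
    _ = (L : ℝ) ^ D * (ε * G + η * γ) * w y := by ring

end Summit.QuantumFields.BalabanUV.Beta.GAN24.CellRefinement
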